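import Summits.BirchSwinnertonDyer.BirchSwinnertonDyer.Theorems.ByReductionTypeAtTwoRankOneAtTwoOneDoorLawDefs
import Summits.BirchSwinnertonDyer.Rank1Residual.F1Sign2.ArchReciprocityAtTwo
import Literature.NumberTheory.EllipticCurves.SerreOpenImageOrdinaryInertiaProofs
import Literature.NumberTheory.EllipticCurves.GlobalMinimalModel
import Literature.NumberTheory.EllipticCurves.BSDShaProofs
import Literature.NumberTheory.EllipticCurves.BSDRootNumberSmallConductorProofs
import Mathlib.NumberTheory.LegendreSymbol.JacobiSymbol
import Mathlib.Data.Nat.Squarefree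
import Mathlib.Data.Nat.Factorization.Basic
import HarnessLib

/-!
# Route ByReductionTypeAtTwo, crux `RankOneAtTwoBigImageOddLocal` (stmt-BirchSwinnertonDyer-23715), LINE v8 `one_door_analytic`:
# the PARITY LAYER of the door law — `t ≡ [Δ < 0] (mod 2)` at every door, and AN-28c holds modulo `2`

Lead prover seat `bsd-line-fkl-p1` g7 (2026-08-28), `--supports stmt-BirchSwinnertonDyer-23715`.  The load-bearing conjecture of
the line of record (`@[conjecture] DoorIndexLawFullCAtTwo`, AN-28c: `2m + [Δ_W<0] = s_E + s_d + t + 2s + 2·v₂(c)`) cannot fail by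
PARITY.  Two elementary facts, proved here unconditionally resp. modulo the Cassels–Tate pairing (a printed theorem, the tree's
named fact `exists_casselsTate_pairing`):

* `transpCount_mod_two_of_doorAdmissible` — for a globally minimal `W` and a door-admissible `d` (`d < 0` square-free,
  `d ≡ 1 (mod 8)`, every prime of `d` good, `(d/ℓ) = 1` at every odd bad prime `ℓ`), the number `t` of transposition primes
  (`q ∣ d` with `(Δ_W/q) = −1`) satisfies `t ≡ [Δ_W < 0] (mod 2)`.  Proof: `(−1)^t = J(Δ_min | |d|)` (every `q ∣ d` is good, so
  `q ∤ Δ_min` and `(Δ_min/q) = ±1`; `|d|` square-free — `neg_one_pow_transpCount_eq_jacobiSym`), and `J(Δ_min | |d|) = sign Δ_min`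
  is the analytic lens' archimedean reciprocity AN-22J already in the tree (`F1Sign2.ArchReciprocity.jacobiSym_natAbs_eq_of_split`,
  -an g7 / -ty g3: quadratic reciprocity with `|d| ≡ 7 (mod 8)` and `(d/ℓ) = 1` at the odd bad `ℓ`), applicable at a door because
  every odd prime of `Δ_min` is bad.  (AN-22's census already observed «parity of transposition primes = [Δ < 0]» on 473 999 pairs;
  this file is that observation as a kernel theorem in the door law's own currency `transpCount`.)
* `doorIndexLawFullC_sides_congr_mod_two` — with `Ш(W)` and `Ш(Wd)` finite, the Cassels–Tate pairing makes `#Ш[2^∞]` a square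
  (`isSquare_card_sha_of_finite_of_casselsTate`), so `s_E`, `s_d` are even and the two sides of AN-28c's identity are congruent
  modulo `2` for EVERY exponent `m` and EVERY constant `c`: a violation of the door law, if any, has even defect.

Nothing here asserts AN-28c; BSD is not proved by any of this.
-/

set_option autoImplicit false

noncomputable section

open scoped Classical

set_option linter.dupNamespace false

namespace Summit.BirchSwinnertonDyer.BirchSwinnertonDyer.Theorems.RankOneAtTwoOneDoor

open WeierstrassCurve Literature.NumberTheory.EllipticCurves Literature.NumberTheory.EllipticCurves.ModularForms
  Summit.BirchSwinnertonDyer.Rank1Residual.F1Sign2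
  Summit.BirchSwinnertonDyer.Rank1Residual.F1Sign2.TranspositionDoor

/-! ### §1 The Jacobi symbol over a finset product -/

/-- `J(a | ∏_{q ∈ s} q) = ∏_{q ∈ s} J(a | q)` for a finset of non-zero naturals (Mathlib's `jacobiSym.mul_right'`, iterated).
[folklore] -/
theorem jacobiSym_finset_prod_right (a : ℤ) (s : Finset ℕ) :
    (∀ q ∈ s, q ≠ 0) → jacobiSym a (∏ q ∈ s, q) = ∏ q ∈ s, jacobiSym a q := by
  refine Finset.induction_on s (fun _ => by simp [jacobiSym.one_right]) ?_
  intro q s hq ih hs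
  have hq0 : q ≠ 0 := hs q (Finset.mem_insert_self q s)
  have hs' : ∀ r ∈ s, r ≠ 0 := fun r hr => hs r (Finset.mem_insert_of_mem hr)
  have hprod : ∏ r ∈ s, r ≠ 0 := Finset.prod_ne_zero_iff.mpr hs'
  rw [Finset.prod_insert hq, Finset.prod_insert hq, jacobiSym.mul_right' a hq0 hprod, ih hs']

/-! ### §2 `(−1)^t = J(Δ_min | |d|)` -/

/-- **`(−1)^{t(W,d)} = J(Δ_min | |d|)`** for a door-admissible `d`: every prime `q ∣ d` is a good prime, so `q ∤ Δ_min` and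
`(Δ_min/q) = ±1`, equal to `−1` exactly at the transposition primes; `|d|` is square-free, so the product of these signs over
`q ∣ d` is the Jacobi symbol. [folklore] -/
theorem neg_one_pow_transpCount_eq_jacobiSym (W : WeierstrassCurve ℚ) [W.IsElliptic] [W.IsGloballyMinimal] {d : ℤ}
    (hadm : DoorAdmissible W d) :
    (-1 : ℤ) ^ transpCount W d = jacobiSym (minimalDiscriminantInt W) d.natAbs := by
  obtain ⟨hdneg, hsqf, -, hgood, -⟩ := hadm
  have hsqn : Squarefree d.natAbs := Int.squarefree_natAbs.mpr hsqf
  -- at each prime factor `q` of `d.natAbs`: `J((minimalDiscriminantInt W) | q) = ±1`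
  have hpm : ∀ q ∈ d.natAbs.primeFactors, jacobiSym (minimalDiscriminantInt W) q = 1 ∨ jacobiSym (minimalDiscriminantInt W) q = -1 := by
    intro q hq
    have hqP : q.Prime := Nat.prime_of_mem_primeFactors hq
    haveI : Fact q.Prime := ⟨hqP⟩
    have hqd : (q : ℤ) ∣ d := Int.natCast_dvd.mpr (Nat.dvd_of_mem_primeFactors hq)
    have hqD : ¬ (q : ℤ) ∣ (minimalDiscriminantInt W) := W.not_dvd_minimalDiscriminantInt_of_hasGoodReductionAtPrime' q (hgood q hqP hqd ⟨hqP⟩)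
    refine jacobiSym.eq_one_or_neg_one ?_
    have hcop : Nat.Coprime (minimalDiscriminantInt W).natAbs q :=
      ((Nat.Prime.coprime_iff_not_dvd hqP).mpr fun h => hqD (Int.natCast_dvd.mpr h)).symm
    simpa [Int.gcd, Int.natAbs_natCast] using hcop
  -- the product of the signs over the prime factors
  have hprod : ∏ q ∈ d.natAbs.primeFactors, jacobiSym (minimalDiscriminantInt W) q = (-1 : ℤ) ^ transpCount W d := by
    have hsplit := Finset.prod_filter_mul_prod_filter_not d.natAbs.primeFactors (fun q => jacobiSym (minimalDiscriminantInt W) q = -1)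
      (fun q => jacobiSym (minimalDiscriminantInt W) q)
    rw [← hsplit]
    have h1 : ∏ q ∈ d.natAbs.primeFactors.filter (fun q => jacobiSym (minimalDiscriminantInt W) q = -1), jacobiSym (minimalDiscriminantInt W) q =
        (-1 : ℤ) ^ (d.natAbs.primeFactors.filter (fun q => jacobiSym (minimalDiscriminantInt W) q = -1)).card := by
      rw [← Finset.prod_const]
      exact Finset.prod_congr rfl fun q hq => (Finset.mem_filter.mp hq).2
    have h2 : ∏ q ∈ d.natAbs.primeFactors.filter (fun q => ¬ jacobiSym (minimalDiscriminantInt W) q = -1), jacobiSym (minimalDiscriminantInt W) q = 1 :=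
      Finset.prod_eq_one fun q hq => by
        obtain ⟨hq', hne⟩ := Finset.mem_filter.mp hq
        exact (hpm q hq').resolve_right hne
    rw [h1, h2, mul_one]
    unfold transpCount
    rw [ArchReciprocity.num_Δ_eq_minimalDiscriminantInt]
  rw [← hprod, ← jacobiSym_finset_prod_right (minimalDiscriminantInt W) d.natAbs.primeFactors fun q hq => (Nat.prime_of_mem_primeFactors hq).ne_zero,
    Nat.prod_primeFactors_of_squarefree hsqn]

/-! ### §3 `J(Δ_min | |d|) = sign Δ_min` — the analytic lens' archimedean reciprocity AN-22J, read at a door -/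

/-- **`J(Δ_min | |d|) = sign(Δ_W)`** for a door-admissible `d`: the tree's AN-22J
(`F1Sign2.ArchReciprocity.jacobiSym_natAbs_eq_of_split`, planner -an g7: quadratic reciprocity with `|d| ≡ 7 (mod 8)`) applies
because every odd prime `ℓ ∣ Δ_min` is a bad prime, where door-admissibility gives `(d/ℓ) = 1`. [folklore] -/
theorem jacobiSym_minimalDiscriminantInt_natAbs_of_doorAdmissible (W : WeierstrassCurve ℚ) [W.IsElliptic]
    [W.IsGloballyMinimal] {d : ℤ} (hadm : DoorAdmissible W d) :
    jacobiSym (minimalDiscriminantInt W) d.natAbs = if W.Δ < 0 then -1 else 1 := by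
  obtain ⟨hdneg, -, hd8, -, hjac⟩ := hadm
  have hΔQ : ((minimalDiscriminantInt W : ℤ) : ℚ) = W.Δ := cast_minimalDiscriminantInt W
  have hD0 : minimalDiscriminantInt W ≠ 0 := by
    intro h
    apply W.isUnit_Δ.ne_zero
    rw [← hΔQ, h, Int.cast_zero]
  have hsplit : ∀ ℓ : ℕ, ℓ.Prime → ℓ ≠ 2 → (ℓ : ℤ) ∣ minimalDiscriminantInt W → jacobiSym d ℓ = 1 :=
    fun ℓ hℓ hℓ2 hℓΔ => hjac ℓ hℓ hℓ2 fun hF hgoodℓ => by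
      haveI := hF
      exact (W.not_dvd_minimalDiscriminantInt_of_hasGoodReductionAtPrime' ℓ hgoodℓ) hℓΔ
  rw [ArchReciprocity.jacobiSym_natAbs_eq_of_split hD0 hdneg hd8 hsplit]
  have hΔpos : 0 < minimalDiscriminantInt W ↔ 0 < W.Δ := by rw [← hΔQ]; exact_mod_cast Iff.rfl
  by_cases hneg : W.Δ < 0
  · rw [if_pos hneg, if_neg (fun h => lt_asymm hneg (hΔpos.mp h))]
  · have hpos : 0 < W.Δ := lt_of_le_of_ne (not_lt.mp hneg) (W.isUnit_Δ.ne_zero).symm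
    rw [if_neg hneg, if_pos (hΔpos.mpr hpos)]

/-! ### §4 The parity of the transposition count, and AN-28c modulo `2` -/

/-- **`t(W, d) ≡ [Δ_W < 0] (mod 2)`** for every globally minimal `W` and every door-admissible `d`: the number of transposition
primes of the door has the parity of the sign indicator of the discriminant (`(−1)^t = J(Δ_min | |d|) = sign Δ_min`). [folklore] -/
theorem transpCount_mod_two_of_doorAdmissible (W : WeierstrassCurve ℚ) [W.IsElliptic] [W.IsGloballyMinimal] {d : ℤ}
    (hadm : DoorAdmissible W d) :
    transpCount W d % 2 = if W.Δ < 0 then 1 else 0 := by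
  have h := neg_one_pow_transpCount_eq_jacobiSym W hadm
  rw [jacobiSym_minimalDiscriminantInt_natAbs_of_doorAdmissible W hadm] at h
  rcases Nat.even_or_odd (transpCount W d) with he | ho
  · rw [he.neg_one_pow] at h
    by_cases hΔ : W.Δ < 0
    · rw [if_pos hΔ] at h; norm_num at h
    · rw [if_neg hΔ]; exact Nat.even_iff.mp he
  · rw [ho.neg_one_pow] at h
    by_cases hΔ : W.Δ < 0
    · rw [if_pos hΔ]; exact Nat.odd_iff.mp ho
    · rw [if_neg hΔ] at h; norm_num at h

/-- **`ord₂ #Ш[2^∞]` is even for a finite `Ш`**, granting the Cassels–Tate pairing (the tree's named fact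
`exists_casselsTate_pairing`; Cassels 1962 / Tate 1963; Silverman AEC X.4.14): `#Ш` is a square and `Ш[2^∞]` is its `2`-Sylow
part. [cite: SilvermanAEC2009, Thm. X.4.14] -/
theorem even_padicValNat_card_primaryComponent_sha (hCT : exists_casselsTate_pairing (K := ℚ))
    (V : WeierstrassCurve ℚ) [V.IsElliptic] [Finite V.sha] :
    Even (padicValNat 2 (Nat.card (AddCommGroup.primaryComponent V.sha 2))) := by
  haveI : Fact (Nat.Prime 2) := ⟨Nat.prime_two⟩
  rw [padicValNat_card_addPrimaryComponent 2]
  obtain ⟨r, hr⟩ := isSquare_card_sha_of_finite_of_casselsTate hCT V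
  haveI : Nonempty V.sha := ⟨0⟩
  have hr0 : r ≠ 0 := by
    intro h
    rw [h, mul_zero] at hr
    exact (Nat.card_pos (α := V.sha)).ne' hr
  rw [hr, padicValNat.mul hr0 hr0]
  exact ⟨_, rfl⟩

/-- **AN-28c holds modulo `2`.**  For a globally minimal `W` with `Ш(W)` finite, a door-admissible `d`, any elliptic `Wd/ℚ` with
`Ш(Wd)` finite (on the line: a minimal model of the twist `W^{(d)}`), granting the Cassels–Tate pairing: for EVERY `m : ℕ` and
EVERY constant `c : ℤ` the two sides of the door law `2m + [Δ_W<0] = s_E + s_d + t + 2s + 2·v₂(c)` are congruent modulo `2`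
(`s_E`, `s_d` even by Cassels–Tate, `t ≡ [Δ_W<0]` by `transpCount_mod_two_of_doorAdmissible`).  So the conjecture carries no
parity information and a violating census row, if one existed, would have even defect.  Nothing asserted about AN-28c itself.
[cite: SilvermanAEC2009, Thm. X.4.14] -/
theorem doorIndexLawFullC_sides_congr_mod_two (hCT : exists_casselsTate_pairing (K := ℚ))
    (W : WeierstrassCurve ℚ) [W.IsElliptic] [W.IsGloballyMinimal] [Finite W.sha] {d : ℤ} (hadm : DoorAdmissible W d)
    (Wd : WeierstrassCurve ℚ) [Wd.IsElliptic] [Finite Wd.sha] (m : ℕ) (c : ℤ) :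
    (2 * m + (if W.Δ < 0 then 1 else 0)) % 2 =
      (padicValNat 2 (Nat.card (AddCommGroup.primaryComponent W.sha 2)) +
        padicValNat 2 (Nat.card (AddCommGroup.primaryComponent Wd.sha 2)) +
        transpCount W d + 2 * identCount W d + 2 * padicValInt 2 c) % 2 := by
  obtain ⟨a, ha⟩ := even_padicValNat_card_primaryComponent_sha hCT W
  obtain ⟨b, hb⟩ := even_padicValNat_card_primaryComponent_sha hCT Wd
  have ht := transpCount_mod_two_of_doorAdmissible W hadm
  rw [ha, hb]
  split_ifs at ht ⊢ <;> omega

end Summit.BirchSwinnertonDyer.BirchSwinnertonDyer.Theorems.RankOneAtTwoOneDoor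

end
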